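import Summits.AtomisticToContinuum.Crystallization.Theorems.ReggeStarCoercivityDefectFreeCrystallizesLayeredGluing
import Literature.Geometry.DiscreteGeometry.LayerShellPatterns
import Literature.Geometry.DiscreteGeometry.TwoShellPatterns

/-!
# Crux `HullMinimality.LayeredWindows` (stmt-AtomisticToContinuum-11778), line `registered`:
# the two-shell sites of a box template (lead c4; part 1 of the necessity direction)

Pure geometry of the LAYERED TEMPLATES `layeredPos a s z` (`InBox a z`: in-layer spacing `a ∈ [47/50, 1]`,
interlayer increments in `[39a/50, 17a/20]`; `IsHaggSeq s`; normalised `z 0 = 0`) of the crux's windows: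

* `site_class_two` — every non-zero site of norm `≤ 38a/25` is one of the EIGHTEEN two-shell sites of
  the origin site: the in-layer hexagon (`hexLabels`), the near triangles of layers `±1`
  (`upLabels (s 0)`, `downLabels (s (-1))`) and the far triangles of layers `±1` (second shell, distance
  `≈ √2·a`; written inline);  layers `±2` start at height `39a/25 > 38a/25`;
* `frame_identity` — the close-packing frame `closePackingFrame τ` of `LayerShellPatterns` carries a
  scaled integer vector to the IDEAL site (heights `idealZ a`) whose layer coordinates satisfy three
  linear relations;
* `fcc_sites_bookkeeping`, `hcp_sites_bookkeeping` (and converses) — by `decide`: the eighteen vectors of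
  the integer models of the fcc / hcp two-shell patterns correspond, through those relations, exactly to
  the eighteen labels, the fcc pattern when the letters below and above agree (`s (-1) = s 0`), the hcp
  pattern when they differ.

Part 2 (`HullMinimalityLayeredWindowsNecessity`) turns this into: a particle deep inside an
`(R, 1/200)`-window of a `1/3`-separated configuration is two-shell good, hence `LayeredWindows` implies the
frequently-in-`N` form of the line's positional stub S1.
-/

noncomputable section

open scoped BigOperators Classical

namespace Summit.AtomisticToContinuum.Crystallization.Theorems.LayeredWindowsLocal

open Summit.AtomisticToContinuum.Crystallization.Theorems.PrestressSplitKorn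
open Literature.MathematicalPhysics.StatisticalMechanics Literature.Geometry.DiscreteGeometry

/-! ## Integer forms -/

/-- Integer solutions of `i² + ij + j² ≤ 2`: the form does not take the value `2`, so these are the
solutions of `≤ 1`. -/
theorem int_form_le_two {i j : ℤ} (h : i ^ 2 + i * j + j ^ 2 ≤ 2) : i ^ 2 + i * j + j ^ 2 ≤ 1 := by
  have hj : j ^ 2 ≤ 2 := by nlinarith [sq_nonneg (2 * i + j)]
  have hi : i ^ 2 ≤ 2 := by nlinarith [sq_nonneg (2 * j + i)]
  have hj1 : -1 ≤ j ∧ j ≤ 1 := by constructor <;> nlinarith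
  have hi1 : -1 ≤ i ∧ i ≤ 1 := by constructor <;> nlinarith
  obtain ⟨hi1, hi2⟩ := hi1
  obtain ⟨hj1, hj2⟩ := hj1
  interval_cases i <;> interval_cases j <;> simp_all

/-- Integer solutions of `i² + ij + j² + σ(i + j) = 1` for a sign `σ`: the far triangle
`(1, -1), (-1, 1), (-σ, -σ)`. -/
theorem int_form_shift_eq_one {i j σ : ℤ} (hσ : σ = 1 ∨ σ = -1)
    (h : i ^ 2 + i * j + j ^ 2 + σ * (i + j) = 1) :
    (i, j) = (1, -1) ∨ (i, j) = (-1, 1) ∨ (i, j) = (-σ, -σ) := by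
  rcases hσ with rfl | rfl
  · have hj : (3 * j + 1) ^ 2 ≤ 16 := by nlinarith [sq_nonneg (2 * i + j + 1)]
    have hi : (3 * i + 1) ^ 2 ≤ 16 := by nlinarith [sq_nonneg (2 * j + i + 1)]
    have hj1 : -1 ≤ j ∧ j ≤ 1 := by constructor <;> nlinarith
    have hi1 : -1 ≤ i ∧ i ≤ 1 := by constructor <;> nlinarith
    obtain ⟨hi1, hi2⟩ := hi1
    obtain ⟨hj1, hj2⟩ := hj1
    interval_cases i <;> interval_cases j <;> simp_all
  · have hj : (3 * j - 1) ^ 2 ≤ 16 := by nlinarith [sq_nonneg (2 * i + j - 1)]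
    have hi : (3 * i - 1) ^ 2 ≤ 16 := by nlinarith [sq_nonneg (2 * j + i - 1)]
    have hj1 : -1 ≤ j ∧ j ≤ 1 := by constructor <;> nlinarith
    have hi1 : -1 ≤ i ∧ i ≤ 1 := by constructor <;> nlinarith
    obtain ⟨hi1, hi2⟩ := hi1
    obtain ⟨hj1, hj2⟩ := hj1
    interval_cases i <;> interval_cases j <;> simp_all

/-! ## Classification of the two-shell sites -/

section Sites

variable {a : ℝ} {s : ℤ → ℤ} {z : ℤ → ℝ}

/-- **Classification of the two-shell sites (coordinates).** A nonzero site of a normalised box template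
of norm `≤ 38a/25` lies in layer `0` (the hexagon) or in layers `±1` (near triangle, form value `0`, or
far triangle, form value `1`). -/
theorem site_class_two_coord (hbox : InBox a z) (hs : IsHaggSeq s) (hz0 : z 0 = 0) {m i j : ℤ}
    (hl0 : (m, i, j) ≠ (0, 0, 0)) (hl : ‖layeredPos a s z (m, i, j)‖ ≤ 38 / 25 * a) :
    (m = 0 ∧ ((i, j) = (1, 0) ∨ (i, j) = (-1, 0) ∨ (i, j) = (0, 1) ∨ (i, j) = (0, -1) ∨
      (i, j) = (1, -1) ∨ (i, j) = (-1, 1))) ∨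
    (m = 1 ∧ ((i, j) = (0, 0) ∨ (i, j) = (-(s 0), 0) ∨ (i, j) = (0, -(s 0)) ∨
      (i, j) = (1, -1) ∨ (i, j) = (-1, 1) ∨ (i, j) = (-(s 0), -(s 0)))) ∨
    (m = -1 ∧ ((i, j) = (0, 0) ∨ (i, j) = (s (-1), 0) ∨ (i, j) = (0, s (-1)) ∨
      (i, j) = (1, -1) ∨ (i, j) = (-1, 1) ∨ (i, j) = (s (-1), s (-1)))) := by
  have ha := hbox.1
  have ha1 := hbox.2.1
  have hapos := hbox.a_pos
  have hsq : ‖layeredPos a s z (m, i, j)‖ ^ 2 ≤ (38 / 25 * a) ^ 2 :=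
    pow_le_pow_left₀ (norm_nonneg _) hl 2
  rw [norm_sq_layeredPos] at hsq
  have hzm : |z m| ≤ 38 / 25 * a := by
    have := (show |(layeredPos a s z (m, i, j)) 2| ≤ ‖layeredPos a s z (m, i, j)‖ by
      simpa only [Real.norm_eq_abs] using PiLp.norm_apply_le (layeredPos a s z (m, i, j)) 2)
    rw [layeredPos_apply_two] at this
    exact this.trans hl
  -- the layer is `-1, 0, 1`: `|z m| ≥ 39a/25` for `|m| ≥ 2`
  have hm1 : -1 ≤ m ∧ m ≤ 1 := by
    have hsm := hbox.strictMono
    have hz2 := hbox.z_two hz0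
    have hzn2 := hbox.z_neg_two hz0
    obtain ⟨hzm1, hzm2⟩ := abs_le.1 hzm
    constructor
    · by_contra hc
      push Not at hc
      have : z m ≤ z (-2) := hsm.monotone (by omega)
      linarith [hzn2.1]
    · by_contra hc
      push Not at hc
      have : z 2 ≤ z m := hsm.monotone (by omega)
      linarith [hz2.1]
  have hQnn : (0 : ℝ) ≤ (i : ℝ) ^ 2 + i * j + (j : ℝ) ^ 2 := by nlinarith [sq_nonneg ((i : ℝ) + j)]
  obtain ⟨hm1, hm1'⟩ := hm1
  interval_cases m
  · -- layer `-1`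
    right; right
    refine ⟨rfl, ?_⟩
    simp only [Int.reduceNeg, haggLabel_neg_one, Int.cast_neg] at hsq
    have hσ := hs (-1)
    have hσ2 : ((s (-1) : ℤ) : ℝ) ^ 2 = 1 := by rcases hσ with h | h <;> simp [h]
    have hz1 := hbox.z_neg_one hz0
    set K : ℤ := i ^ 2 + i * j + j ^ 2 + (-(s (-1))) * (i + j) with hK
    have hKr : a ^ 2 * ((K : ℝ) + 1 / 3) + z (-1) ^ 2 ≤ (38 / 25 * a) ^ 2 := by
      rw [hK]; push_cast; nlinarith [hsq, hσ2]
    have hK2 : (K : ℝ) < 2 := by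
      by_contra hc
      push Not at hc
      nlinarith [hz1.1, hz1.2]
    have hK1 : K ≤ 1 := by
      have : K < 2 := by exact_mod_cast hK2
      omega
    have hσ' : (-(s (-1)) : ℤ) = 1 ∨ (-(s (-1)) : ℤ) = -1 := by rcases hσ with h | h <;> simp [h]
    rcases lt_or_eq_of_le hK1 with hK0 | hKeq
    · have hK0' : i ^ 2 + i * j + j ^ 2 + (-(s (-1))) * (i + j) ≤ 0 := by rw [hK] at hK0; omega
      rcases int_form_shift_le_zero hσ' hK0' with h | h | h
      · exact Or.inl h
      · right; left; simpa using h
      · right; right; left; simpa using h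
    · have hKeq' : i ^ 2 + i * j + j ^ 2 + (-(s (-1))) * (i + j) = 1 := by rw [hK] at hKeq; exact hKeq
      rcases int_form_shift_eq_one hσ' hKeq' with h | h | h
      · right; right; right; left; exact h
      · right; right; right; right; left; exact h
      · right; right; right; right; right; simpa using h
  · -- layer `0`
    left
    refine ⟨rfl, ?_⟩
    simp only [haggLabel_zero, Int.cast_zero, zero_mul, add_zero, hz0] at hsq
    have hQ2 : ((i : ℝ) ^ 2 + i * j + (j : ℝ) ^ 2) < 3 := by nlinarith
    have hQ : i ^ 2 + i * j + j ^ 2 ≤ 2 := by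
      have : ((i ^ 2 + i * j + j ^ 2 : ℤ) : ℝ) < 3 := by push_cast; linarith
      have : i ^ 2 + i * j + j ^ 2 < 3 := by exact_mod_cast this
      omega
    rcases int_form_le_one (int_form_le_two hQ) with h | h
    · exfalso; apply hl0; simp_all
    · exact h
  · -- layer `1`
    right; left
    refine ⟨rfl, ?_⟩
    simp only [haggLabel_one] at hsq
    have hσ := hs 0
    have hσ2 : ((s 0 : ℤ) : ℝ) ^ 2 = 1 := by rcases hσ with h | h <;> simp [h]
    have hz1 := hbox.z_one hz0
    set K : ℤ := i ^ 2 + i * j + j ^ 2 + (s 0) * (i + j) with hK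
    have hKr : a ^ 2 * ((K : ℝ) + 1 / 3) + z 1 ^ 2 ≤ (38 / 25 * a) ^ 2 := by
      rw [hK]; push_cast; nlinarith [hsq, hσ2]
    have hK2 : (K : ℝ) < 2 := by
      by_contra hc
      push Not at hc
      nlinarith [hz1.1, hz1.2]
    have hK1 : K ≤ 1 := by
      have : K < 2 := by exact_mod_cast hK2
      omega
    rcases lt_or_eq_of_le hK1 with hK0 | hKeq
    · have hK0' : i ^ 2 + i * j + j ^ 2 + (s 0) * (i + j) ≤ 0 := by rw [hK] at hK0; omega
      rcases int_form_shift_le_zero hσ hK0' with h | h | h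
      · exact Or.inl h
      · exact Or.inr (Or.inl h)
      · exact Or.inr (Or.inr (Or.inl h))
    · have hKeq' : i ^ 2 + i * j + j ^ 2 + (s 0) * (i + j) = 1 := by rw [hK] at hKeq; exact hKeq
      rcases int_form_shift_eq_one hσ hKeq' with h | h | h
      · exact Or.inr (Or.inr (Or.inr (Or.inl h)))
      · exact Or.inr (Or.inr (Or.inr (Or.inr (Or.inl h))))
      · exact Or.inr (Or.inr (Or.inr (Or.inr (Or.inr h))))

/-- **Classification of the two-shell sites (labels).** A nonzero site of a normalised box template of
norm `≤ 38a/25` is one of the eighteen two-shell labels: the hexagon, the near triangles of layers `±1`,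
or the far triangles `{(1,1,-1), (1,-1,1), (1,-σ,-σ)}` (`σ = s 0`) and `{(-1,1,-1), (-1,-1,1), (-1,σ',σ')}`
(`σ' = s (-1)`). -/
theorem site_class_two (hbox : InBox a z) (hs : IsHaggSeq s) (hz0 : z 0 = 0) {l : ℤ × ℤ × ℤ}
    (hl0 : l ≠ 0) (hl : ‖layeredPos a s z l‖ ≤ 38 / 25 * a) :
    l ∈ hexLabels ∪ upLabels (s 0) ∪ downLabels (s (-1)) ∪
      ({((1 : ℤ), (1 : ℤ), (-1 : ℤ)), (1, -1, 1), (1, -(s 0), -(s 0))} : Finset (ℤ × ℤ × ℤ)) ∪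
      ({((-1 : ℤ), (1 : ℤ), (-1 : ℤ)), (-1, -1, 1), (-1, s (-1), s (-1))} : Finset (ℤ × ℤ × ℤ)) := by
  obtain ⟨m, i, j⟩ := l
  rcases site_class_two_coord hbox hs hz0 hl0 hl with ⟨rfl, h⟩ | ⟨rfl, h⟩ | ⟨rfl, h⟩
  · rcases h with h | h | h | h | h | h <;>
      · simp only [Prod.mk.injEq] at h
        obtain ⟨rfl, rfl⟩ := h
        simp [hexLabels]
  · rcases h with h | h | h | h | h | h <;>
      · simp only [Prod.mk.injEq] at h
        obtain ⟨rfl, rfl⟩ := h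
        simp [upLabels]
  · rcases h with h | h | h | h | h | h <;>
      · simp only [Prod.mk.injEq] at h
        obtain ⟨rfl, rfl⟩ := h
        simp [downLabels]

end Sites

/-! ## The close-packing frame carries scaled integer vectors to ideal sites -/

/-- **Frame identity.** For a sign `τ`, a scale `c` with `c√2 = κ` and an integer vector `t` with
`S = t₀ + t₁ + t₂`: if the reals `m, i, j, L` satisfy `m = κS/2`, `3i + L = κτ(3t₁ - S)`,
`3j + L = κτ(3t₂ - S)`, then `a • A_τ (c t) = i u(a) + j v(a) + L w(a) + m √(2/3) a e₃`. -/
theorem frame_identity {τ : ℝ} (hτ : τ = 1 ∨ τ = -1) (a c κ : ℝ) (hc : c * Real.sqrt 2 = κ)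
    (t : Fin 3 → ℤ) (m i j L : ℝ)
    (hm : m = κ * ((t 0 : ℝ) + t 1 + t 2) / 2)
    (hi : 3 * i + L = κ * τ * (3 * (t 1 : ℝ) - ((t 0 : ℝ) + t 1 + t 2)))
    (hj : 3 * j + L = κ * τ * (3 * (t 2 : ℝ) - ((t 0 : ℝ) + t 1 + t 2))) :
    a • closePackingFrame τ hτ (c • intVec t) =
      i • triangularVec₁ a + j • triangularVec₂ a + L • barlowOffset a +
        (m * (Real.sqrt (2 / 3) * a)) • layerNormal 1 := by
  have hL : L = κ * τ * (3 * (t 1 : ℝ) - ((t 0 : ℝ) + t 1 + t 2)) - 3 * i := by linarith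
  subst hL
  have hj' : j = κ * τ * ((t 2 : ℝ) - t 1) + i := by linarith
  subst hj'
  subst hm
  ext l
  fin_cases l
  · simp [triangularVec₁, triangularVec₂, barlowOffset, layerNormal]
    linear_combination (-(a * τ * ((t 0 : ℝ) - t 1) / 2)) * hc
  · simp [triangularVec₁, triangularVec₂, barlowOffset, layerNormal]
    linear_combination (-(a * τ * Real.sqrt 3 * ((t 0 : ℝ) + t 1 - 2 * t 2) / 6)) * hc
  · have hh : layerSpacing = 2 * Real.sqrt (2 / 3) := rfl
    have hs23 : Real.sqrt (2 / 3) = Real.sqrt 2 / Real.sqrt 3 := Real.sqrt_div (by norm_num) 3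
    simp [triangularVec₁, triangularVec₂, barlowOffset, layerNormal]
    linear_combination (a * layerSpacing * ((t 0 : ℝ) + t 1 + t 2) / 4) * hc +
      (a * κ * ((t 0 : ℝ) + t 1 + t 2) / 4) * hh +
      (a * κ * ((t 0 : ℝ) + t 1 + t 2) / 2) * hs23

/-! ## Bookkeeping: pattern vectors ↔ labels (by `decide`) -/

/-- **fcc pattern → labels.** (`σ` the common letter below and above.) Every vector `t` of the integer
model of the fcc two-shell pattern has layer coordinates `(m, i, j)` among the eighteen labels with
`S = 2m`, `3i + σm = σ(3t₁ - S)`, `3j + σm = σ(3t₂ - S)`. -/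
theorem fcc_sites_bookkeeping {σ : ℤ} (hσ : σ = 1 ∨ σ = -1) :
    ∀ t ∈ fccInt ∪ fccSecondShellInt,
      ∃ m ∈ Finset.Icc (-1 : ℤ) 1, ∃ i ∈ Finset.Icc (-1 : ℤ) 1, ∃ j ∈ Finset.Icc (-1 : ℤ) 1,
        t 0 + t 1 + t 2 = 2 * m ∧ 3 * i + σ * m = σ * (3 * t 1 - (t 0 + t 1 + t 2)) ∧
          3 * j + σ * m = σ * (3 * t 2 - (t 0 + t 1 + t 2)) ∧
          (m, i, j) ∈ hexLabels ∪ upLabels σ ∪ downLabels σ ∪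
            ({((1 : ℤ), (1 : ℤ), (-1 : ℤ)), (1, -1, 1), (1, -σ, -σ)} : Finset (ℤ × ℤ × ℤ)) ∪
            ({((-1 : ℤ), (1 : ℤ), (-1 : ℤ)), (-1, -1, 1), (-1, σ, σ)} : Finset (ℤ × ℤ × ℤ)) := by
  rcases hσ with rfl | rfl <;> decide

/-- **Labels → fcc pattern** (converse bookkeeping). -/
theorem fcc_labels_bookkeeping {σ : ℤ} (hσ : σ = 1 ∨ σ = -1) :
    ∀ l ∈ hexLabels ∪ upLabels σ ∪ downLabels σ ∪
        ({((1 : ℤ), (1 : ℤ), (-1 : ℤ)), (1, -1, 1), (1, -σ, -σ)} : Finset (ℤ × ℤ × ℤ)) ∪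
        ({((-1 : ℤ), (1 : ℤ), (-1 : ℤ)), (-1, -1, 1), (-1, σ, σ)} : Finset (ℤ × ℤ × ℤ)),
      ∃ t ∈ fccInt ∪ fccSecondShellInt, (-1 ≤ l.1 ∧ l.1 ≤ 1) ∧
        t 0 + t 1 + t 2 = 2 * l.1 ∧ 3 * l.2.1 + σ * l.1 = σ * (3 * t 1 - (t 0 + t 1 + t 2)) ∧
          3 * l.2.2 + σ * l.1 = σ * (3 * t 2 - (t 0 + t 1 + t 2)) := by
  rcases hσ with rfl | rfl <;> decide

/-- **hcp pattern → labels.** (`σ` the letter above, `-σ` the letter below.) Every vector `t` of the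
integer model of the hcp two-shell pattern has layer coordinates `(m, i, j)` among the eighteen labels
with `S = 6m`, `9i + 3σm² = σ(3t₁ - S)`, `9j + 3σm² = σ(3t₂ - S)`. -/
theorem hcp_sites_bookkeeping {σ : ℤ} (hσ : σ = 1 ∨ σ = -1) :
    ∀ t ∈ hcpInt ∪ hcpSecondShellInt,
      ∃ m ∈ Finset.Icc (-1 : ℤ) 1, ∃ i ∈ Finset.Icc (-1 : ℤ) 1, ∃ j ∈ Finset.Icc (-1 : ℤ) 1,
        t 0 + t 1 + t 2 = 6 * m ∧ 9 * i + 3 * (σ * m ^ 2) = σ * (3 * t 1 - (t 0 + t 1 + t 2)) ∧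
          9 * j + 3 * (σ * m ^ 2) = σ * (3 * t 2 - (t 0 + t 1 + t 2)) ∧
          (m, i, j) ∈ hexLabels ∪ upLabels σ ∪ downLabels (-σ) ∪
            ({((1 : ℤ), (1 : ℤ), (-1 : ℤ)), (1, -1, 1), (1, -σ, -σ)} : Finset (ℤ × ℤ × ℤ)) ∪
            ({((-1 : ℤ), (1 : ℤ), (-1 : ℤ)), (-1, -1, 1), (-1, -σ, -σ)} : Finset (ℤ × ℤ × ℤ)) := by
  rcases hσ with rfl | rfl <;> decide

/-- **Labels → hcp pattern** (converse bookkeeping). -/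
theorem hcp_labels_bookkeeping {σ : ℤ} (hσ : σ = 1 ∨ σ = -1) :
    ∀ l ∈ hexLabels ∪ upLabels σ ∪ downLabels (-σ) ∪
        ({((1 : ℤ), (1 : ℤ), (-1 : ℤ)), (1, -1, 1), (1, -σ, -σ)} : Finset (ℤ × ℤ × ℤ)) ∪
        ({((-1 : ℤ), (1 : ℤ), (-1 : ℤ)), (-1, -1, 1), (-1, -σ, -σ)} : Finset (ℤ × ℤ × ℤ)),
      ∃ t ∈ hcpInt ∪ hcpSecondShellInt, (-1 ≤ l.1 ∧ l.1 ≤ 1) ∧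
        t 0 + t 1 + t 2 = 6 * l.1 ∧ 9 * l.2.1 + 3 * (σ * l.1 ^ 2) = σ * (3 * t 1 - (t 0 + t 1 + t 2)) ∧
          9 * l.2.2 + 3 * (σ * l.1 ^ 2) = σ * (3 * t 2 - (t 0 + t 1 + t 2)) := by
  rcases hσ with rfl | rfl <;> decide

/-- Landing anchor of this file (registered sub-goal of crux stmt-AtomisticToContinuum-11778; re-exports
`int_form_shift_eq_one`, the far-triangle computation behind `site_class_two`). -/
theorem twoShellSites_anchor : ∀ (i j σ : ℤ), (σ = 1 ∨ σ = -1) → i ^ 2 + i * j + j ^ 2 + σ * (i + j) = 1 → (i, j) = (1, -1) ∨ (i, j) = (-1, 1) ∨ (i, j) = (-σ, -σ) :=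
  fun _ _ _ hσ h => int_form_shift_eq_one hσ h

end Summit.AtomisticToContinuum.Crystallization.Theorems.LayeredWindowsLocal

end
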